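import Literature.NumberTheory.Automorphic.ShimuraCurveRibetTakahashiFreyCubicProofs
import Literature.NumberTheory.Automorphic.BrandtSetupAdmissible
import Literature.NumberTheory.Automorphic.BrandtXiSetupIndependence
import HarnessLib

/-!
# Pasten's Thm. 6.1 (b) in Ribet–Takahashi's coordinates: the component-group package of the
# telescoping from Takahashi's degree formulae over the tree's Brandt modules

Topic `NumberTheory/Automorphic`; a proofs-only companion (theorems only: no definition, no named
fact, nothing restated; D-0026) of `ShimuraCurveRibetTakahashi.lean`, written by the seat of its
named fact `Literature.NumberTheory.Automorphic.PastenShimura2024_thm_6_1_b` (H. Pasten, *Shimura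
curves and the abc conjecture*, J. Number Theory 254 (2024) 214–335 = arXiv:1705.09251, Thm. 6.1 (b)
p. 20: for `E` semistable with `M` not prime, or `E` Frey–Hellegouarch with two odd primes in `M`,
the denominator of `γ_{D,M,E} = δ_{1,N}/(δ_{D,M} ∏_{p∣D} v_p(Δ_E))` divides `κ^{ω(D)}`).

**The point.** Pasten's §6.6–6.9 (Lemma 6.14, Lemmas 6.15–6.16, Thm. 6.17, the telescoping of
§6.9) and every Diophantine input of the printed proof are theorems of the tree, assembled in
`PastenShimura2024_thm_6_1_b_of_ribetTakahashi_treeFacts'''` (`…FreyCubicProofs.lean`). What that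
assembly still takes as free hypotheses, besides six named facts, is the COMPONENT-GROUP PACKAGE of
§6.6: two undefined functions `cI`, `cJ` ("`i_p(D,M) = # image`, `j_p(D,M) = # coker` of
`q_{D,M,p,*} : Φ_p(J₀^D(M)) → Φ_p(A_{D,M})`") and, about them, Prop. 6.13 (`h613`, Ribet–Takahashi
1997 Thm. 2), "`j_p ∣ c_p(A_{D,M})`" (`hJc`) and Ribet's Eisenstein divisibility (`hEis`) — none of
which can even be STATED as a fact of the tree, which has no Néron model of a Jacobian. But the tree
does have the coordinates in which Ribet–Takahashi and Takahashi COMPUTE these numbers: Brandt setups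
`Brandt.XiSetup N⁺ N⁻` (a definite quaternion algebra over `ℚ` of discriminant `N⁻` with an Eichler
order of level `N⁺`, `BrandtXi.lean`), the self-pairing `S.xi λ = Σ_i w_i φ_i²` of the `λ`-eigenline
of its Brandt matrices and its setup-free value `brandtXi N⁺ N⁻ λ`; setups exist exactly for
admissible types (`Brandt.nonempty_xiSetup_iff_admissible`, PROVED) and `ξ` does not depend on the
setup (`Brandt.XiSetup.xi_eq_xi`, PROVED). The parallel seat of
`PastenShimura2024_pairwise_denominator` used them at `d = 1` (`…PairwiseTakahashiProofs.lean`); this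
file runs the WHOLE telescoping (every `d ∣ D`) in them. The printed statements used, read in
S. Takahashi, *Degrees of parametrizations of elliptic curves by Shimura curves*, J. Number Theory 90
(2001) 74–88 (held text, pp. 77–84):

* §2 pp. 77–78 (ANY admissible `(D, M)`, `J = J₀^D(M)`, an optimal quotient `π : J → E` of degree
  `δ = δ_D(M)`, a prime `r ∣ N`): `c_r = #Φ_r(E)`, `i_r = #image(π_*)`, `j_r = #coker(π_*)`,
  `h_r = u_J(g_r, g_r)` the monodromy self-pairing of a generator of the `f`-eigenline
  `L_r(J) ⊂ X_r(J)` of the character group; p. 79 "`j_r = c_r / i_r`";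
  **Theorem 2.3** (p. 79): *"`i_r` divides `h_r`, and `δ = (h_r/i_r) · j_r`"*; p. 80: *"The results
  stated so far are true for any prime `r` dividing `N`."*
* the dictionary `h_r = ξ`: (level side, `r ∥ M`, `M = r m`) *"`X_r(J₀^{(d/r)}(rm))` is canonically
  isomorphic to the group of degree-`0` divisors on the set of isomorphism classes of locally free
  rank-`1` right modules over the Eichler order of level `m` in the definite quaternion algebra of
  discriminant `d` … compatible with the action of Hecke operators … as well as with the monodromy
  pairings"* (p. 84, proof of Thm. 3.8, from Buzzard 1997 Thm. 4.7; `D = 1`: Ribet 1990 §3,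
  Deligne–Rapoport) — Brandt type `(m, D r)`; (discriminant side, `r ∣ D`) Prop. 3.1 p. 82 (Ribet's
  exact sequence `0 → X_p(J₀^{dpq}(m)) → X_q(J₀^d(pqm)) → X_q(J₀^d(qm))² → 0`, Hecke- and
  pairing-compatible; = Ribet–Takahashi 1997 Prop. 1, Ribet 1990 Thm. 4.1 at `d = 1`) and
  **Thm. 3.2 (a)** p. 82: *"`h_q = h'_p`"* — so for `r ∣ D` and any other prime `s ∣ D`,
  `h_r(J₀^D(M)) = h_s(J₀^{D/(rs)}(rsM))`, of Brandt type `(rM, D/r)` by the level-side dictionary.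
  (Takahashi's Thm. 2.4 / Thm. 3.2 (b), (c) — "`j_r = 1` for `r ∣ D`" — are NOT used: their proof has
  a gap, Pasten p. 24 after Lemma 6.14, citing Papikian–Rabinoff 2016.)
* Pasten p. 23, proof of Lemma 6.14: *"The group `Φ_p(J₀^D(M))` is Eisenstein in the sense that for
  `r ∤ N`, the Hecke operator `T_r` acts on it as multiplication by `r + 1` (cf. [Ribet, Sém. Théor.
  Nombres Bordeaux 1987–88, exp. 6]) … It follows that `i_p(J₀^D(M), χ_{D,M})` divides
  `r + 1 − a_r(A_{D,M})` for every prime `r ∤ N`"* (`p ∥ M`; Ribet–Takahashi 1997, proof of Prop. 3).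

In these coordinates Prop. 6.13 DECOMPOSES, for every `d` (not only `d = 1`), into two instances of
Thm. 2.3 with the SAME `h`: for `N = d · prM` admissible, `D = dpr`, and a Brandt setup of type
`(rM, dp)`,

  `δ_{d,prM} · i_p(d,prM) = ξ · j_p(d,prM)`, `i_p j_p = c_p(A_{d,prM})` (Thm. 2.3 for `X₀^d(prM)` at
  `p ∥ prM`: level side, type `(rM, d·p)`),
  `δ_{dpr,M} · i_r(dpr,M) = ξ · j_r(dpr,M)`, `i_r j_r = c_r(A_{dpr,M})` (Thm. 2.3 for `X₀^{dpr}(M)`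
  at `r ∣ dpr`: discriminant side, type `(rM, dpr/r)` — the same type),

with one `ξ = brandtXi (rM) (dp) (a(E))` because `a_n(A_{d,prM}) = a_n(E) = a_n(A_{dpr,M})` (isogeny
invariance, tree theorem `LFunction_eq_of_isIsogenous_holds`) and `ξ` is setup-independent; whence
`δ_{d,prM} i_p(d,prM)² j_r(dpr,M)² = δ_{dpr,M} (i_p j_p)(i_r j_r) = δ_{dpr,M} c_p(A_{d,prM}) c_r(A_{dpr,M})`
— Prop. 6.13, first line (the second line is the same with `p ↔ r`), which is how Ribet–Takahashi
prove their Thm. 2. Likewise `j_p ∣ c_p` is `i_p j_p = c_p`, and the Eisenstein divisibility is a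
statement about the `i` of the (unique: `level_solution_eq`; the parallel seat's `unique_image`)
solution of Thm. 2.3's system.

## Contents (all sorry-free)

* §I `prop_6_13_identity_of_thm_2_3` (the algebra above), `pos_of_thm_2_3` (`δ, i ≥ 1 ⟹ j, h ≥ 1`),
  `choice_spec_of_exists` / `choice_pos` (the selection by choice used in §IV).
* §II `IsAdmissibleFactorization.nonempty_xiSetup_level` / `…_disc`: for `N = DM` admissible, Brandt
  setups of the level type `(M/p, Dp)` (`p ∥ M`) and of the discriminant type `(pM, D/p)` (`p ∣ D`)
  exist (`ω` odd, squarefree, coprime; `Brandt.nonempty_xiSetup_iff_admissible`).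
* §III (section `Coordinates`): for ANY functions `cI`, `cJ` of Shimura data that select a solution
  `i` of the level system `{0 < i, i j = c_p(W'), δ i = ξ j}` (resp. `j` of the discriminant system)
  whenever one exists (`hcI`, `hcJ`), Takahashi's Thm. 2.3 on both sides (`hTlev`, `hT2`) gives
  `prop_6_13_of_takahashi` (= the hypothesis `h613` of `…_treeFacts'''`, every `d`),
  `coker_dvd_of_takahashi` (= `hJc`), and with the Eisenstein divisibility in coordinates (`hEis`)
  `image_dvd_of_takahashi` (= the abstract `hEis`); `level_solution_eq` records that such a `cI P p`
  IS Takahashi's `i_p` (uniqueness); `PastenShimura2024_thm_6_1_b_of_takahashi_coordinates` feeds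
  `…_treeFacts'''`.
* §IV `PastenShimura2024_thm_6_1_b_of_takahashi_treeFacts` — **the trust base after this file**:
  `cI`, `cJ` := the selections by choice (junk value `1` where no solution exists), so that
  `PastenShimura2024_thm_6_1_b` follows from the six named facts of `…_treeFacts'''`
  (`mazurKenku_exists_cyclic_isogeny`, `mestreOesterle1989_thm_1`,
  `nonempty_shimuraParametrizationData`, `ribet1997_twoPowerFermat`, `darmonMerel1997_denesEquation`,
  Mathlib's `FermatLastTheorem`) and FOUR PRINTED THEOREMS, each now one self-contained statement over
  the tree's vocabulary with no undefined function in it (ready to be vendored verbatim as a named fact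
  and fed here): (`hTlev`) Takahashi 2001 Thm. 2.3 for `X₀^D(M)` at `p ∥ M`, type `(M/p, Dp)` — whose
  case `D = 1` in the classical idiom is the tree's fact
  `Literature.NumberTheory.EllipticCurves.takahashi2001_thm_2_3_of_coprime`; (`hT2`) Thm. 2.3 with
  Thm. 3.2 (a) for `X₀^D(M)` at `p ∣ D`, type `(pM, D/p)` — VERBATIM the `hT2` of
  `…PairwiseTakahashiProofs`; (`hEis`) Ribet's Eisenstein property as used by Pasten (Lemma 6.14,
  proof), in coordinates, for `X₀^D(M)` at `p ∥ M`; (`h67`) Pasten's Lemma 6.7 for one finite set of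
  primes `S ∋ 2`, verbatim the `h67` of the sibling files.

Rendering conventions are those of the Pasten facts and of `takahashi2001_thm_2_3_of_coprime`:
`δ_{D,M}` = `P.deg` for `P.IsMinimalFor W` on `X : ShimuraCurveData D M` (the datum's curve
`W' ≅ A_{D,M}`), `c_p(A) = ord_p Δ_min(W') = (W'.minimalDiscriminantNorm ℤ).factorization p` (Pasten
p. 22), `a_n = W'.LFunction n`, `h = S.xi (a(W'))` for every setup `S` of the stated type; scope: `N`
with an admissible factorisation and `p` of multiplicative reduction (`p ∥ N`), as in
`takahashi2001_thm_2_3_of_coprime` and Pasten's remark in the proof of Prop. 6.13 ("does not need `M`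
to be squarefree").

## References

* H. Pasten, *Shimura curves and the abc conjecture*, J. Number Theory 254 (2024) 214–335 =
  arXiv:1705.09251: Thm. 6.1 p. 20, Lemma 6.7/6.8 p. 22, §6.4 p. 22 (`c_p = v_p(Δ)`), §6.6,
  Prop. 6.13 and Lemma 6.14 (with proof) p. 23, remark p. 24, §6.9 p. 25 (held text, read).
  [PastenShimura2024]
* S. Takahashi, *Degrees of parametrizations of elliptic curves by Shimura curves*, J. Number Theory
  90 (2001) 74–88: §2 pp. 77–80 (Lemma 2.1–2.2, Thm. 2.3, remark p. 80), §3.1 p. 82 (Prop. 3.1,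
  Thm. 3.2 (a)), §3.2 p. 84 (proof of Thm. 3.8) (held text, read). [Takahashi2001]
* K. A. Ribet, S. Takahashi, *Parametrizations of elliptic curves by Shimura curves and by classical
  modular curves*, PNAS 94 (1997) 11110–11114, Prop. 1, Thm. 2, Prop. 3 (cited through Pasten and
  Takahashi; not held — acquisition requested). [RibetTakahashi1997]
* K. A. Ribet, Invent. Math. 100 (1990), §3, Thm. 4.1 [Ribet1990]; K. A. Ribet, Sém. Théor. Nombres
  Bordeaux 1987–88, exp. 6 [RibetComponentGroups1988]; K. Buzzard, Duke Math. J. 87 (1997), Thm. 4.7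
  [Buzzard1997].

## Mathlib / tree search

Tree (reused): `PastenShimura2024_thm_6_1_b_of_ribetTakahashi_treeFacts'''`,
`Brandt.nonempty_xiSetup_iff_admissible`, `Brandt.XiSetup.brandtXi_eq_xi` (setup independence),
`LFunction_eq_of_isIsogenous_holds`, `IsAdmissibleFactorization.erase_two_primes`,
`ShimuraParametrizationData.deg_pos` (the uniqueness argument of `level_solution_eq` is that of the
parallel seat's `unique_image`, `…PairwiseTakahashiProofs`, not imported). No Néron model / component group
of a Jacobian exists in Mathlib or the tree; none is needed here.
-/

noncomputable section

open scoped MatrixGroups ModularForm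

namespace Literature.NumberTheory.Automorphic

open Literature.NumberTheory.EllipticCurves (mazurKenku_exists_cyclic_isogeny
  mestreOesterle1989_thm_1 LFunction_eq_of_isIsogenous_holds)
open Literature.NumberTheory.EllipticCurves.ModularForms (ModularParametrizationData IsNewformOf)
open Literature.NumberTheory.DiophantineGeometry (ribet1997_twoPowerFermat
  darmonMerel1997_denesEquation)

/-! ## I. Arithmetic: Prop. 6.13 from two instances of Thm. 2.3 with the same `h` -/

/-- **Ribet–Takahashi's computation of `δ_{d,prM}/δ_{dpr,M}` (their Thm. 2 = Pasten's Prop. 6.13)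
from Takahashi's Thm. 2.3 on both curves with the same self-pairing `h`**: if
`δ₁ i₁ = h j₁`, `i₁ j₁ = c₁` (level side) and `δ₂ i₂ = h j₂`, `i₂ j₂ = c₂` (discriminant side),
then `δ₁ · i₁² j₂² = δ₂ · c₁ c₂`. [cite: Takahashi2001, Thm. 2.3 (p. 79) and Thm. 3.2 (a) (p. 82)] [cite: PastenShimura2024, Prop. 6.13 p. 23] -/
theorem prop_6_13_identity_of_thm_2_3 {δ₁ δ₂ ξ i₁ j₁ i₂ j₂ c₁ c₂ : ℕ}
    (h₁ : δ₁ * i₁ = ξ * j₁) (hc₁ : i₁ * j₁ = c₁) (h₂ : δ₂ * i₂ = ξ * j₂) (hc₂ : i₂ * j₂ = c₂) :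
    δ₁ * (i₁ ^ 2 * j₂ ^ 2) = δ₂ * (c₁ * c₂) := by
  subst hc₁ hc₂
  calc δ₁ * (i₁ ^ 2 * j₂ ^ 2) = (δ₁ * i₁) * i₁ * j₂ ^ 2 := by ring
    _ = ξ * j₁ * i₁ * j₂ ^ 2 := by rw [h₁]
    _ = (i₁ * j₁) * (ξ * j₂) * j₂ := by ring
    _ = (i₁ * j₁) * (δ₂ * i₂) * j₂ := by rw [h₂]
    _ = δ₂ * ((i₁ * j₁) * (i₂ * j₂)) := by ring

/-- In Thm. 2.3, `δ ≥ 1` and `i ≥ 1` force `j ≥ 1` and `h ≥ 1` (Takahashi p. 78: "`L_r(J)` is a free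
`ℤ`-module of rank one", so `h_r ≠ 0`; `j_r = c_r / i_r ≥ 1` at a prime of bad reduction).
[cite: Takahashi2001, §2 p. 78 and Thm. 2.3 (p. 79)] -/
theorem pos_of_thm_2_3 {δ ξ i j : ℕ} (hδ : 0 < δ) (hi : 0 < i) (h : δ * i = ξ * j) :
    0 < j ∧ 0 < ξ := by
  have hpos : 0 < ξ * j := h ▸ Nat.mul_pos hδ hi
  exact ⟨Nat.pos_of_mul_pos_left hpos, Nat.pos_of_mul_pos_right hpos⟩

/-- The selection by choice used in §IV satisfies the selected property whenever a witness exists.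
[folklore] -/
theorem choice_spec_of_exists (Q : ℕ → Prop) [Decidable (∃ i, Q i)] (hex : ∃ i, Q i) :
    Q (if h : ∃ i, Q i then Classical.choose h else 1) := by
  rw [dif_pos hex]; exact Classical.choose_spec hex

/-- The selection by choice used in §IV is positive (junk value `1`). [folklore] -/
theorem choice_pos (Q : ℕ → Prop) [Decidable (∃ i, Q i)] (hQ : ∀ i, Q i → 0 < i) :
    0 < (if h : ∃ i, Q i then Classical.choose h else 1) := by
  split_ifs with h
  · exact hQ _ (Classical.choose_spec h)
  · exact one_pos

/-! ## II. Brandt setups of the two types exist -/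

/-- **The level type.** For `N = DM` admissible and `p ∥ M` (`M = p m`, `p ∤ m`), a Brandt setup of
type `(m, Dp)` exists: `m ≥ 1`, `Dp` is squarefree with `ω(Dp) = ω(D) + 1` odd, `gcd(m, Dp) = 1` —
the definite quaternion algebra of discriminant `Dp` with an Eichler order of level `m`, in whose
Brandt module `X_p(J₀^D(pm))` lives (Takahashi p. 84 / Buzzard Thm. 4.7; `D = 1`: Ribet 1990 §3).
[cite: Takahashi2001, §3.2 p. 84 (proof of Thm. 3.8)] [cite: VignerasLNM800, Ch. III §3 Thm. 3.1] -/
theorem IsAdmissibleFactorization.nonempty_xiSetup_level {N D M p m : ℕ}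
    (hadm : IsAdmissibleFactorization N D M) (hp : p.Prime) (hM : M = p * m) (hpm : ¬ p ∣ m) :
    Nonempty (Brandt.XiSetup m (D * p)) := by
  have hm : 0 < m := Nat.pos_of_mul_pos_left (hM ▸ hadm.pos_right)
  have hpD : ¬ p ∣ D := fun h => by
    have : p ∣ Nat.gcd D M := Nat.dvd_gcd h (hM ▸ Dvd.intro m rfl)
    rw [hadm.coprime] at this
    exact hp.one_lt.ne' (Nat.dvd_one.mp this)
  have hDp : D.Coprime p := (Nat.coprime_comm.mp ((Nat.Prime.coprime_iff_not_dvd hp).mpr hpD))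
  refine Brandt.nonempty_xiSetup_iff_admissible.mpr ⟨hm, ?_, ?_, ?_⟩
  · exact Nat.squarefree_mul_iff.mpr ⟨hDp, hadm.squarefree, hp.prime.squarefree⟩
  · rw [hDp.primeFactors_mul, hp.primeFactors,
      Finset.card_union_of_disjoint (hp.primeFactors ▸ hDp.disjoint_primeFactors),
      Finset.card_singleton]
    exact hadm.even_card_primeFactors.add_one
  · have hmM : m ∣ M := hM ▸ Dvd.intro_left p rfl
    exact Nat.Coprime.mul_right (Nat.Coprime.coprime_dvd_left hmM hadm.coprime.symm)
      (Nat.coprime_comm.mp ((Nat.Prime.coprime_iff_not_dvd hp).mpr hpm))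

/-- **The discriminant type.** For `N = DM` admissible and `p ∣ D` (`D = p d`), a Brandt setup of type
`(pM, d)` exists: `ω(d) = ω(D) − 1` is odd, `d` squarefree, `gcd(pM, d) = 1` — the definite
quaternion algebra of discriminant `D/p` with an Eichler order of level `pM`, in whose Brandt module
`X_p(J₀^D(M))` embeds (Takahashi Prop. 3.1 = Ribet–Takahashi 1997 Prop. 1, with p. 84).
[cite: Takahashi2001, Prop. 3.1 (p. 82) and §3.2 p. 84] [cite: VignerasLNM800, Ch. III §3 Thm. 3.1] -/
theorem IsAdmissibleFactorization.nonempty_xiSetup_disc {N D M p d : ℕ}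
    (hadm : IsAdmissibleFactorization N D M) (hp : p.Prime) (hD : D = p * d) :
    Nonempty (Brandt.XiSetup (p * M) d) := by
  have hsq : p.Coprime d ∧ Squarefree p ∧ Squarefree d :=
    Nat.squarefree_mul_iff.mp (hD ▸ hadm.squarefree)
  obtain ⟨hpd, -, hsqd⟩ := hsq
  refine Brandt.nonempty_xiSetup_iff_admissible.mpr
    ⟨Nat.mul_pos hp.pos hadm.pos_right, hsqd, ?_, ?_⟩
  · have heven := hadm.even_card_primeFactors
    rw [hD, hpd.primeFactors_mul, hp.primeFactors,
      Finset.card_union_of_disjoint (hp.primeFactors ▸ hpd.disjoint_primeFactors),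
      Finset.card_singleton, add_comm] at heven
    exact Nat.not_even_iff_odd.mp (Nat.even_add_one.mp heven)
  · have hdD : d ∣ D := hD ▸ Dvd.intro_left p rfl
    exact Nat.Coprime.mul_left hpd (Nat.Coprime.coprime_dvd_left hdD hadm.coprime).symm

/-! ## III. The coordinates -/

section Coordinates

variable
  /- (`hTlev`) **Takahashi 2001, Thm. 2.3 for `X₀^D(M)` at a prime `p ∥ M` (level side)** (p. 79:
  "`i_r` divides `h_r`, and `δ = (h_r/i_r) · j_r`"; p. 80: "true for any prime `r` dividing `N`";
  p. 84: for `M = p m`, `X_p(J₀^D(pm))` is the degree-`0` Brandt module of the Eichler order of level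
  `m` in the definite quaternion algebra of discriminant `Dp`, Hecke- and pairing-compatibly, so
  `h_p = S.xi (a(A_{D,M}))` for every setup `S` of type `(m, Dp)`). Rendering as in
  `takahashi2001_thm_2_3_of_coprime` (its case `D = 1`, classical idiom) and in the Pasten facts:
  `N = DM` admissible, `W/ℚ` of conductor `N` fixing the class, `P` on `X : ShimuraCurveData D M` with
  `P.IsMinimalFor W` (`P.deg = δ_{D,M}`, `W' ≅ A_{D,M}`, `c_p(A_{D,M}) = ord_p Δ_min(W')`). -/
  (hTlev : ∀ {N D M p m : ℕ}, p.Prime → M = p * m → ¬ p ∣ m → IsAdmissibleFactorization N D M →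
    ∀ (X : ShimuraCurveData D M) (W : WeierstrassCurve ℚ) [W.IsElliptic], W.conductorNorm ℤ = N →
    ∀ (W' : WeierstrassCurve ℚ) [W'.IsElliptic] (P : ShimuraParametrizationData X W'),
      P.IsMinimalFor W →
    ∀ S : Brandt.XiSetup m (D * p),
      ∃ i j : ℕ, 0 < i ∧ i * j = (W'.minimalDiscriminantNorm ℤ).factorization p ∧
        i ∣ S.xi (fun n => W'.LFunction n) ∧
        P.deg * i = S.xi (fun n => W'.LFunction n) * j)
  /- (`hT2`) **Takahashi 2001, Thm. 2.3 for `X₀^D(M)` at a prime `p ∣ D`, with Thm. 3.2 (a)**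
  (discriminant side; p. 82: "`h_q = h'_p`" for `J = J₀^d(pqm)`, `J' = J₀^{dpq}(m)`, so
  `h_p(J₀^D(M)) = S.xi (a(A_{D,M}))` for the setups `S` of type `(pM, D/p)`) — VERBATIM the hypothesis
  `hT2` of `ShimuraCurveRibetTakahashiPairwiseTakahashiProofs.lean`. -/
  (hT2 : ∀ {N D M p d : ℕ}, p.Prime → D = p * d → IsAdmissibleFactorization N D M →
    ∀ (X : ShimuraCurveData D M) (W : WeierstrassCurve ℚ) [W.IsElliptic],
      W.conductorNorm ℤ = N →
    ∀ (W' : WeierstrassCurve ℚ) [W'.IsElliptic] (P : ShimuraParametrizationData X W'),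
      P.IsMinimalFor W →
    ∀ S : Brandt.XiSetup (p * M) d,
      ∃ i j : ℕ, 0 < i ∧ i * j = (W'.minimalDiscriminantNorm ℤ).factorization p ∧
        i ∣ S.xi (fun n => W'.LFunction n) ∧
        P.deg * i = S.xi (fun n => W'.LFunction n) * j)
  /- (`hEis`) **Ribet's Eisenstein property of `Φ_p(J₀^D(M))`, `p ∥ M`, as used in Pasten's proof of
  Lemma 6.14** (p. 23: "`T_r` acts on it as multiplication by `r + 1` … It follows that
  `i_p(J₀^D(M), χ_{D,M})` divides `r + 1 − a_r(A_{D,M})` for every prime `r ∤ N`"; Ribet, Sém. Théor.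
  Nombres Bordeaux 1987–88 exp. 6; Ribet–Takahashi 1997, proof of Prop. 3), in the coordinates and
  under the hypotheses of `hTlev`: for every solution `(i, j)` of `i j = ord_p Δ_min(W')`,
  `δ_{D,M} i = S.xi (a(W')) j` (i.e. for `(i_p, j_p)`, `level_solution_eq`) and every prime `ℓ ∤ N`:
  `i ∣ ℓ + 1 − a_ℓ(W')`. Its case `D = 1` in the classical idiom is the `hEis` of
  `…PairwiseTakahashiProofs`. -/
  (hEis : ∀ {N D M p m : ℕ}, p.Prime → M = p * m → ¬ p ∣ m → IsAdmissibleFactorization N D M →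
    ∀ (X : ShimuraCurveData D M) (W : WeierstrassCurve ℚ) [W.IsElliptic], W.conductorNorm ℤ = N →
    ∀ (W' : WeierstrassCurve ℚ) [W'.IsElliptic] (P : ShimuraParametrizationData X W'),
      P.IsMinimalFor W →
    ∀ (S : Brandt.XiSetup m (D * p)) (i j : ℕ), 0 < i →
      i * j = (W'.minimalDiscriminantNorm ℤ).factorization p →
      P.deg * i = S.xi (fun n => W'.LFunction n) * j →
      ∀ ℓ : ℕ, ℓ.Prime → ¬ ℓ ∣ N → (i : ℤ) ∣ (ℓ + 1 : ℤ) - W'.LFunction ℓ)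
  /- The coordinates: ANY two functions of Shimura data and primes … -/
  (cI cJ : ∀ {D M : ℕ} {X : ShimuraCurveData D M} {W' : WeierstrassCurve ℚ},
    ShimuraParametrizationData X W' → ℕ → ℕ)
  /- … such that `cI P p` solves the level system at `(P, p)` — `0 < i`, `i j = ord_p Δ_min(W')`,
  `P.deg · i = ξ j` with `ξ = brandtXi (M/p) (Dp) (a(W'))` — whenever that system has a solution … -/
  (hcI : ∀ {D M : ℕ} {X : ShimuraCurveData D M} {W' : WeierstrassCurve ℚ}
    (P : ShimuraParametrizationData X W') (p : ℕ),
    (∃ i : ℕ, 0 < i ∧ ∃ j : ℕ, i * j = (W'.minimalDiscriminantNorm ℤ).factorization p ∧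
      P.deg * i = brandtXi (M / p) (D * p) (fun n => W'.LFunction n) * j) →
    0 < cI P p ∧ ∃ j : ℕ, cI P p * j = (W'.minimalDiscriminantNorm ℤ).factorization p ∧
      P.deg * cI P p = brandtXi (M / p) (D * p) (fun n => W'.LFunction n) * j)
  /- … and `cJ P p` solves (as the `j`) the discriminant system at `(P, p)` — `0 < j`,
  `i j = ord_p Δ_min(W')`, `P.deg · i = ξ j` with `ξ = brandtXi (pM) (D/p) (a(W'))` — whenever that
  system has a solution with `j > 0`. -/
  (hcJ : ∀ {D M : ℕ} {X : ShimuraCurveData D M} {W' : WeierstrassCurve ℚ}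
    (P : ShimuraParametrizationData X W') (p : ℕ),
    (∃ j : ℕ, 0 < j ∧ ∃ i : ℕ, i * j = (W'.minimalDiscriminantNorm ℤ).factorization p ∧
      P.deg * i = brandtXi (p * M) (D / p) (fun n => W'.LFunction n) * j) →
    0 < cJ P p ∧ ∃ i : ℕ, i * cJ P p = (W'.minimalDiscriminantNorm ℤ).factorization p ∧
      P.deg * i = brandtXi (p * M) (D / p) (fun n => W'.LFunction n) * cJ P p)

include hTlev hcI in
/-- **`cI P p` is Takahashi's `i_p(D, M)`**: under Thm. 2.3 on the level side, for `P` minimal on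
`X₀^D(M)` and `p ∥ M`, every solution `(i, j)` of the level system in any setup `S` of type
`(M/p, Dp)` has `i = cI P p` — the system has exactly one solution (`δ i² = ξ i j = ξ c` pins `i²`;
the parallel seat's `unique_image`), and `cI` selects
it. [cite: Takahashi2001, Thm. 2.3 (p. 79)] -/
theorem level_solution_eq {N D M p m : ℕ} (hp : p.Prime) (hM : M = p * m) (hpm : ¬ p ∣ m)
    (hadm : IsAdmissibleFactorization N D M) (X : ShimuraCurveData D M) (W : WeierstrassCurve ℚ)
    [W.IsElliptic] (hWN : W.conductorNorm ℤ = N) (W' : WeierstrassCurve ℚ) [W'.IsElliptic]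
    (P : ShimuraParametrizationData X W') (hP : P.IsMinimalFor W) (S : Brandt.XiSetup m (D * p))
    {i j : ℕ} (hc : i * j = (W'.minimalDiscriminantNorm ℤ).factorization p)
    (hδ : P.deg * i = S.xi (fun n => W'.LFunction n) * j) : i = cI P p := by
  obtain ⟨i₀, j₀, hi₀, hc₀, -, hδ₀⟩ := hTlev hp hM hpm hadm X W hWN W' P hP S
  rw [← S.brandtXi_eq_xi] at hδ₀
  have hdiv : M / p = m := by rw [hM]; exact Nat.mul_div_cancel_left _ hp.pos
  obtain ⟨-, j', hc', hδ'⟩ := hcI P p ⟨i₀, hi₀, j₀, hc₀, by rw [hdiv]; exact hδ₀⟩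
  rw [hdiv, S.brandtXi_eq_xi] at hδ'
  -- `δ i² = ξ c = δ i'²` with `δ > 0`
  have key : P.deg * (i * i) = P.deg * (cI P p * cI P p) :=
    calc P.deg * (i * i) = (P.deg * i) * i := by ring
      _ = S.xi (fun n => W'.LFunction n) * j * i := by rw [hδ]
      _ = S.xi (fun n => W'.LFunction n) * (i * j) := by ring
      _ = S.xi (fun n => W'.LFunction n) * (cI P p * j') := by rw [hc, hc']
      _ = (S.xi (fun n => W'.LFunction n) * j') * cI P p := by ring
      _ = (P.deg * cI P p) * cI P p := by rw [hδ']
      _ = P.deg * (cI P p * cI P p) := by ring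
  exact Nat.mul_self_inj.mp (Nat.eq_of_mul_eq_mul_left P.deg_pos key)

include hTlev hT2 hcI hcJ in
/-- **Pasten 2024, Prop. 6.13 (= Ribet–Takahashi 1997, Thm. 2), first line, for EVERY `d`, from
Takahashi's Thm. 2.3 on both sides** — exactly the hypothesis `h613` of
`PastenShimura2024_thm_6_1_b_of_ribetTakahashi_treeFacts'''`: for `N = DM` admissible, `D = d · pr`
with `p ≠ r` prime, `M₁ = prM`, `W` of conductor `N`, `P₁` minimal for `W` on `X₀^d(M₁)` and `P₂`
minimal for `W` on `X₀^D(M)`: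
`δ_{d,prM} · (i_p(d,prM)² · j_r(D,M)²) = δ_{D,M} · (c_p(A_{d,prM}) · c_r(A_{D,M}))`. Proof (module
docstring): `N = d · M₁` is admissible (`erase_two_primes`) with `p ∥ M₁`; a setup `S` of type
`(rM, dp)` exists (§II) and serves both sides; `a(W₁') = a(W) = a(W₂')`; Thm. 2.3 twice;
`prop_6_13_identity_of_thm_2_3`. [cite: PastenShimura2024, Prop. 6.13 p. 23] [cite: Takahashi2001, Thm. 2.3 (p. 79), Prop. 3.1 and Thm. 3.2 (a) (p. 82), p. 84] [cite: RibetTakahashi1997, Thm. 2] -/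
theorem prop_6_13_of_takahashi {N d M₁ D M p r : ℕ} (hp : p.Prime) (hr : r.Prime) (hpr : p ≠ r)
    (hD : D = d * (p * r)) (hM₁ : M₁ = p * r * M) (hadm : IsAdmissibleFactorization N D M)
    (X₁ : ShimuraCurveData d M₁) (X₂ : ShimuraCurveData D M)
    (W : WeierstrassCurve ℚ) [W.IsElliptic] [W.IsGloballyMinimal] (hWN : W.conductorNorm ℤ = N)
    (W₁' : WeierstrassCurve ℚ) [W₁'.IsElliptic] (P₁ : ShimuraParametrizationData X₁ W₁')
    (hP₁ : P₁.IsMinimalFor W)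
    (W₂' : WeierstrassCurve ℚ) [W₂'.IsElliptic] (P₂ : ShimuraParametrizationData X₂ W₂')
    (hP₂ : P₂.IsMinimalFor W) :
    P₁.deg * (cI P₁ p ^ 2 * cJ P₂ r ^ 2) =
      P₂.deg * ((W₁'.minimalDiscriminantNorm ℤ).factorization p *
        (W₂'.minimalDiscriminantNorm ℤ).factorization r) := by
  -- `N = d · (prM)` is admissible, `p ∥ prM`, `D = r · (dp)`
  have hprD : p * r ∣ D := hD ▸ Dvd.intro_left d rfl
  obtain ⟨-, hadm₁, -, -⟩ := hadm.erase_two_primes hp hr hpr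
    ((Dvd.intro r rfl).trans hprD) ((Dvd.intro_left p rfl).trans hprD)
  have hd : D / (p * r) = d := by
    rw [hD]; exact Nat.mul_div_cancel _ (Nat.mul_pos hp.pos hr.pos)
  rw [hd, ← hM₁] at hadm₁
  have hM₁' : M₁ = p * (r * M) := by rw [hM₁]; ring
  have hpM : ¬ p ∣ M := fun h => by
    have h1 : p ∣ Nat.gcd D M := Nat.dvd_gcd ((Dvd.intro r rfl).trans hprD) h
    rw [hadm.coprime] at h1
    exact hp.one_lt.ne' (Nat.dvd_one.mp h1)
  have hprM : ¬ p ∣ r * M := fun h =>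
    ((Nat.Prime.dvd_mul hp).mp h).elim (fun h' => hpr ((Nat.prime_dvd_prime_iff_eq hp hr).mp h'))
      hpM
  have hD' : D = r * (d * p) := by rw [hD]; ring
  -- a common Brandt setup of type `(rM, dp)`, and one eigenvalue system `a(W)`
  obtain ⟨S⟩ := hadm₁.nonempty_xiSetup_level hp hM₁' hprM
  have hL₁ : (fun n => W₁'.LFunction n) = fun n => W.LFunction n := by
    rw [LFunction_eq_of_isIsogenous_holds W W₁' hP₁.1]
  have hL₂ : (fun n => W₂'.LFunction n) = fun n => W.LFunction n := by
    rw [LFunction_eq_of_isIsogenous_holds W W₂' hP₂.1]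
  -- Thm. 2.3 on the level side (`X₀^d(prM)` at `p`) and on the discriminant side (`X₀^D(M)` at `r`)
  obtain ⟨i₁, j₁, hi₁, hc₁, -, hδ₁⟩ := hTlev hp hM₁' hprM hadm₁ X₁ W hWN W₁' P₁ hP₁ S
  obtain ⟨i₂, j₂, hi₂, hc₂, -, hδ₂⟩ := hT2 hr hD' hadm X₂ W hWN W₂' P₂ hP₂ S
  rw [← S.brandtXi_eq_xi] at hδ₁ hδ₂
  have hj₂ : 0 < j₂ := (pos_of_thm_2_3 P₂.deg_pos hi₂ hδ₂).1
  -- the coordinates `i_p(d, prM) = cI P₁ p`, `j_r(D, M) = cJ P₂ r`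
  have hdiv₁ : M₁ / p = r * M := by rw [hM₁']; exact Nat.mul_div_cancel_left _ hp.pos
  have hdiv₂ : D / r = d * p := by rw [hD']; exact Nat.mul_div_cancel_left _ hr.pos
  obtain ⟨-, j₁', hc₁', hδ₁'⟩ := hcI P₁ p ⟨i₁, hi₁, j₁, hc₁, by rw [hdiv₁]; exact hδ₁⟩
  obtain ⟨-, i₂', hc₂', hδ₂'⟩ := hcJ P₂ r ⟨j₂, hj₂, i₂, hc₂, by rw [hdiv₂]; exact hδ₂⟩
  rw [hdiv₁, hL₁] at hδ₁'
  rw [hdiv₂, hL₂] at hδ₂'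
  exact prop_6_13_identity_of_thm_2_3 hδ₁' hc₁' hδ₂' hc₂'

include hT2 hcJ in
/-- **"`j_p(D,M) ∣ c_p(A_{D,M})`" for `p ∣ D`** (Pasten p. 24, proof of Lemma 6.15: "by definition
`j_p(D,M)` divides `c_p(A_{D,M}) = #Φ_p(A_{D,M})`") — exactly the hypothesis `hJc` of
`…_treeFacts'''` — from Thm. 2.3 on the discriminant side: `i_p j_p = c_p` (Takahashi p. 79,
"`j_r = c_r / i_r`"). [cite: Takahashi2001, Thm. 2.3 (p. 79)] [cite: PastenShimura2024, Lemma 6.15 p. 24 (proof)] -/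
theorem coker_dvd_of_takahashi {N D M : ℕ} (hadm : IsAdmissibleFactorization N D M)
    (X : ShimuraCurveData D M) (W : WeierstrassCurve ℚ) [W.IsElliptic] [W.IsGloballyMinimal]
    (hWN : W.conductorNorm ℤ = N) (W' : WeierstrassCurve ℚ) [W'.IsElliptic]
    (P : ShimuraParametrizationData X W') (hP : P.IsMinimalFor W) (p : ℕ) (hp : p.Prime)
    (hpD : p ∣ D) : cJ P p ∣ (W'.minimalDiscriminantNorm ℤ).factorization p := by
  obtain ⟨d, hD⟩ := hpD
  obtain ⟨S⟩ := hadm.nonempty_xiSetup_disc hp hD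
  obtain ⟨i, j, hi, hc, -, hδ⟩ := hT2 hp hD hadm X W hWN W' P hP S
  rw [← S.brandtXi_eq_xi] at hδ
  have hj : 0 < j := (pos_of_thm_2_3 P.deg_pos hi hδ).1
  have hdiv : D / p = d := by rw [hD]; exact Nat.mul_div_cancel_left _ hp.pos
  obtain ⟨-, i', hc', -⟩ := hcJ P p ⟨j, hj, i, hc, by rw [hdiv]; exact hδ⟩
  exact Dvd.intro_left i' hc'

include hTlev hEis hcI in
/-- **The Eisenstein divisibility `i_p(D,M) ∣ r + 1 − a_r(A_{D,M})` (`p ∥ M`, `r ∤ N` prime)** —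
exactly the hypothesis `hEis` of `…_treeFacts'''` over the abstract `cI` — from its coordinate form:
the level system at `(P, p)` has a solution (Thm. 2.3), `cI P p` is one (hence the one), and the
Eisenstein property applies to it. [cite: PastenShimura2024, Lemma 6.14 p. 23 (proof)] [cite: RibetComponentGroups1988, exp. 6] -/
theorem image_dvd_of_takahashi {N D M : ℕ} (hadm : IsAdmissibleFactorization N D M)
    (X : ShimuraCurveData D M) (W : WeierstrassCurve ℚ) [W.IsElliptic] [W.IsGloballyMinimal]
    (hWN : W.conductorNorm ℤ = N) (W' : WeierstrassCurve ℚ) [W'.IsElliptic]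
    (P : ShimuraParametrizationData X W') (hP : P.IsMinimalFor W) (p : ℕ) (hp : p.Prime)
    (hpM : p ∣ M) (hp2 : ¬ p ^ 2 ∣ M) (r : ℕ) (hr : r.Prime) (hrN : ¬ r ∣ N) :
    (cI P p : ℤ) ∣ (r + 1 : ℤ) - W'.LFunction r := by
  obtain ⟨m, hM⟩ := hpM
  have hpm : ¬ p ∣ m := fun h => hp2 (by rw [hM, sq]; exact Nat.mul_dvd_mul_left p h)
  obtain ⟨S⟩ := hadm.nonempty_xiSetup_level hp hM hpm
  obtain ⟨i, j, hi, hc, -, hδ⟩ := hTlev hp hM hpm hadm X W hWN W' P hP S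
  rw [← S.brandtXi_eq_xi] at hδ
  have hdiv : M / p = m := by rw [hM]; exact Nat.mul_div_cancel_left _ hp.pos
  obtain ⟨hI, j', hc', hδ'⟩ := hcI P p ⟨i, hi, j, hc, by rw [hdiv]; exact hδ⟩
  rw [hdiv, S.brandtXi_eq_xi] at hδ'
  exact hEis hp hM hpm hadm X W hWN W' P hP S (cI P p) j' hI hc' hδ' r hr hrN

include hTlev hT2 hEis hcI hcJ in
/-- **Pasten 2024, Thm. 6.1 (b) in Takahashi's coordinates (any selection `cI`, `cJ`).** The tree's
`PastenShimura2024_thm_6_1_b_of_ribetTakahashi_treeFacts'''` with its component-group package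
`(cI, cJ, h613, hJc, hEis)` SUPPLIED by §III from Takahashi's Thm. 2.3 on both sides (`hTlev`, `hT2`)
and the Eisenstein divisibility in coordinates (`hEis`), for any positive functions `cI`, `cJ`
selecting solutions of the level / discriminant systems where they exist (`hcI`, `hcJ`; §IV takes the
selections by choice). Remaining inputs verbatim those of `…_treeFacts'''`: the six named facts and
Lemma 6.7 for one finite `S ∋ 2` (`h67`). [cite: PastenShimura2024, Thm. 6.1 (b) p. 20, Prop. 6.13 and Lemma 6.14 p. 23, §6.9 p. 25] [cite: Takahashi2001, Thm. 2.3 (p. 79), Thm. 3.2 (a) (p. 82), p. 84] -/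
theorem PastenShimura2024_thm_6_1_b_of_takahashi_coordinates
    (hMK : mazurKenku_exists_cyclic_isogeny) (hMO : mestreOesterle1989_thm_1)
    (hP : nonempty_shimuraParametrizationData)
    (hRib : ribet1997_twoPowerFermat) (hDM : darmonMerel1997_denesEquation)
    (hFLT : FermatLastTheorem)
    (hI : ∀ {D M : ℕ} {X : ShimuraCurveData D M} {W' : WeierstrassCurve ℚ}
      (P : ShimuraParametrizationData X W') (p : ℕ), 0 < cI P p)
    (hJ : ∀ {D M : ℕ} {X : ShimuraCurveData D M} {W' : WeierstrassCurve ℚ}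
      (P : ShimuraParametrizationData X W') (p : ℕ), 0 < cJ P p)
    {S : Finset ℕ} (h2S : 2 ∈ S)
    (h67 : ∀ ℓ : ℕ, ℓ.Prime → ∃ β : ℕ, (163 < ℓ → β = 1) ∧
      ∀ (A : WeierstrassCurve ℚ) [A.IsElliptic],
        (∀ q : ℕ, q.Prime → q ∉ S → ¬ q ^ 2 ∣ A.conductorNorm ℤ) →
        ∀ r₀ : ℕ, ∃ r : ℕ, r₀ < r ∧ r.Prime ∧ ¬ ((ℓ ^ β : ℕ) : ℤ) ∣ (r + 1 : ℤ) - A.LFunction r) :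
    PastenShimura2024_thm_6_1_b :=
  PastenShimura2024_thm_6_1_b_of_ribetTakahashi_treeFacts''' hMK hMO hP hRib hDM hFLT cI cJ hI hJ
    (fun hp hr hpr hD hM₁ hadm X₁ X₂ W _ _ hWN W₁' _ P₁ hP₁ W₂' _ P₂ hP₂ =>
      prop_6_13_of_takahashi hTlev hT2 cI cJ hcI hcJ hp hr hpr hD hM₁ hadm X₁ X₂ W hWN W₁' P₁ hP₁
        W₂' P₂ hP₂)
    (fun hadm X W _ _ hWN W' _ P hP p hp hpD =>
      coker_dvd_of_takahashi hT2 cJ hcJ hadm X W hWN W' P hP p hp hpD)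
    h2S
    (fun hadm X W _ _ hWN W' _ P hP p hp hpM hp2 r hr hrN =>
      image_dvd_of_takahashi hTlev hEis cI hcI hadm X W hWN W' P hP p hp hpM hp2 r hr hrN)
    h67

end Coordinates

/-! ## IV. Thm. 6.1 (b) over declarations and four printed theorems -/

/-- **Pasten 2024, Thm. 6.1 (b) over the tree's facts and Ribet–Takahashi's printed theorems — the
trust base after this file.** `PastenShimura2024_thm_6_1_b` from: the named facts
`mazurKenku_exists_cyclic_isogeny` (Mazur 1978 + Kenku 1982; Lemma 6.8), `mestreOesterle1989_thm_1`
(Lemma 6.11), `nonempty_shimuraParametrizationData` (Jacquet–Langlands; the data at the intermediate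
levels of the telescoping), `ribet1997_twoPowerFermat`, `darmonMerel1997_denesEquation`, Mathlib's
statement `FermatLastTheorem` (Lemma 6.12 for `ℓ ≥ 5`); and four printed theorems, each a single
self-contained statement over the tree's vocabulary: (`hTlev`) Takahashi 2001 Thm. 2.3 for `X₀^D(M)`
at `p ∥ M` (Brandt type `(M/p, Dp)`); (`hT2`) Thm. 2.3 with Thm. 3.2 (a) at `p ∣ D` (type `(pM, D/p)`;
verbatim the `hT2` of `…PairwiseTakahashiProofs`); (`hEis`) Ribet's Eisenstein property of
`Φ_p(J₀^D(M))`, `p ∥ M`, in coordinates; (`h67`) Pasten's Lemma 6.7 for one finite `S ∋ 2`. The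
functions `i_p`, `j_p` of §6.6 are no longer inputs: they are the selections by choice of the unique
solutions of Takahashi's systems (`level_solution_eq`), and Prop. 6.13 for every `d`, `j_p ∣ c_p`,
and the abstract Eisenstein divisibility are §III. Nothing in the statement is quantified over an
undefined function. [cite: PastenShimura2024, Thm. 6.1 (b) p. 20, §6.3–6.9 pp. 21–25] [cite: Takahashi2001, Thm. 2.3 (p. 79), Prop. 3.1 and Thm. 3.2 (a) (p. 82), p. 84] [cite: RibetTakahashi1997, Prop. 1, Thm. 2, Prop. 3] -/
theorem PastenShimura2024_thm_6_1_b_of_takahashi_treeFacts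
    (hMK : mazurKenku_exists_cyclic_isogeny) (hMO : mestreOesterle1989_thm_1)
    (hP : nonempty_shimuraParametrizationData)
    (hRib : ribet1997_twoPowerFermat) (hDM : darmonMerel1997_denesEquation)
    (hFLT : FermatLastTheorem)
    (hTlev : ∀ {N D M p m : ℕ}, p.Prime → M = p * m → ¬ p ∣ m → IsAdmissibleFactorization N D M →
      ∀ (X : ShimuraCurveData D M) (W : WeierstrassCurve ℚ) [W.IsElliptic], W.conductorNorm ℤ = N →
      ∀ (W' : WeierstrassCurve ℚ) [W'.IsElliptic] (P : ShimuraParametrizationData X W'),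
        P.IsMinimalFor W →
      ∀ S : Brandt.XiSetup m (D * p),
        ∃ i j : ℕ, 0 < i ∧ i * j = (W'.minimalDiscriminantNorm ℤ).factorization p ∧
          i ∣ S.xi (fun n => W'.LFunction n) ∧
          P.deg * i = S.xi (fun n => W'.LFunction n) * j)
    (hT2 : ∀ {N D M p d : ℕ}, p.Prime → D = p * d → IsAdmissibleFactorization N D M →
      ∀ (X : ShimuraCurveData D M) (W : WeierstrassCurve ℚ) [W.IsElliptic],
        W.conductorNorm ℤ = N →
      ∀ (W' : WeierstrassCurve ℚ) [W'.IsElliptic] (P : ShimuraParametrizationData X W'),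
        P.IsMinimalFor W →
      ∀ S : Brandt.XiSetup (p * M) d,
        ∃ i j : ℕ, 0 < i ∧ i * j = (W'.minimalDiscriminantNorm ℤ).factorization p ∧
          i ∣ S.xi (fun n => W'.LFunction n) ∧
          P.deg * i = S.xi (fun n => W'.LFunction n) * j)
    {S : Finset ℕ} (h2S : 2 ∈ S)
    (hEis : ∀ {N D M p m : ℕ}, p.Prime → M = p * m → ¬ p ∣ m → IsAdmissibleFactorization N D M →
      ∀ (X : ShimuraCurveData D M) (W : WeierstrassCurve ℚ) [W.IsElliptic], W.conductorNorm ℤ = N →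
      ∀ (W' : WeierstrassCurve ℚ) [W'.IsElliptic] (P : ShimuraParametrizationData X W'),
        P.IsMinimalFor W →
      ∀ (S : Brandt.XiSetup m (D * p)) (i j : ℕ), 0 < i →
        i * j = (W'.minimalDiscriminantNorm ℤ).factorization p →
        P.deg * i = S.xi (fun n => W'.LFunction n) * j →
        ∀ ℓ : ℕ, ℓ.Prime → ¬ ℓ ∣ N → (i : ℤ) ∣ (ℓ + 1 : ℤ) - W'.LFunction ℓ)
    (h67 : ∀ ℓ : ℕ, ℓ.Prime → ∃ β : ℕ, (163 < ℓ → β = 1) ∧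
      ∀ (A : WeierstrassCurve ℚ) [A.IsElliptic],
        (∀ q : ℕ, q.Prime → q ∉ S → ¬ q ^ 2 ∣ A.conductorNorm ℤ) →
        ∀ r₀ : ℕ, ∃ r : ℕ, r₀ < r ∧ r.Prime ∧ ¬ ((ℓ ^ β : ℕ) : ℤ) ∣ (r + 1 : ℤ) - A.LFunction r) :
    PastenShimura2024_thm_6_1_b := by
  classical
  exact PastenShimura2024_thm_6_1_b_of_takahashi_coordinates hTlev hT2 hEis
    (fun {D M} {_X} {W'} P p =>
      if h : ∃ i : ℕ, 0 < i ∧ ∃ j : ℕ, i * j = (W'.minimalDiscriminantNorm ℤ).factorization p ∧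
          P.deg * i = brandtXi (M / p) (D * p) (fun n => W'.LFunction n) * j
      then Classical.choose h else 1)
    (fun {D M} {_X} {W'} P p =>
      if h : ∃ j : ℕ, 0 < j ∧ ∃ i : ℕ, i * j = (W'.minimalDiscriminantNorm ℤ).factorization p ∧
          P.deg * i = brandtXi (p * M) (D / p) (fun n => W'.LFunction n) * j
      then Classical.choose h else 1)
    (fun P p hex => choice_spec_of_exists _ hex) (fun P p hex => choice_spec_of_exists _ hex)
    hMK hMO hP hRib hDM hFLT
    (fun P p => choice_pos _ fun i hi => hi.1) (fun P p => choice_pos _ fun j hj => hj.1)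
    h2S h67

end Literature.NumberTheory.Automorphic

end
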